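import Summits.BirchSwinnertonDyer.BirchSwinnertonDyer.Theorems.ByReductionTypeAtTwoFineSelmerConjAAtTwoAdditivePotGoodTwoLayerStampsUnramifiedTwo
import Summits.BirchSwinnertonDyer.BirchSwinnertonDyer.Theorems.ByReductionTypeAtTwoFineSelmerConjAAtTwoAdditivePotGoodClassNumberOneCriterion
import Literature.NumberTheory.NumberFields.DyadicUnitSquaresRamifiedPrime
import Literature.NumberTheory.NumberFields.QuadraticExtensionOddClassNumberNonNormUnit
import Literature.NumberTheory.IwasawaTheory.NarrowFukudaCertificateLayerModels
import HarnessLib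

/-!
# Route `ByReductionTypeAtTwo` (rung K4), crux C1″ `FineSelmerConjAAtTwoAdditivePotGood` (item stmt-BirchSwinnertonDyer-22615, cc C3″ 22617):
# THE CENSUS ROW `293200be1` — A CUBIC UNIT OF ITS TOTALLY REAL POINT FIELD `K = ℚ(θ)` (`θ³ − θ² − 7θ + 8 = 0`, `d = 733`, `𝓞_K = ℤ[θ]`,
# `2 = 𝔭₁𝔭₂` UNRAMIFIED, `f = 1, 2`) WHICH IS NOT A NORM FROM THE SECOND CYCLOTOMIC LAYER `K₂ = K₁(√(2+√2))` DOWN TO `K₁ = K(√2)` — MODEL-FREE, KERNEL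
# (a `--supports 22615` file; seat `bsd-2adic-k4-w1` GEN 12; the `r = 1` input of the COINVARIANT-GENUS road
# `Literature/NumberTheory/IwasawaTheory/ClassGroupCoinvariantGenusCriterion.lean` at `n₀ = 0`: `rank₂ Cl(K₁) + t ≤ 2 + r` ⟹ classical `μ₂(K_cyc) = 0`)

HONEST FRAMING (cell `bsd-2adic`, D-0036/D-0054/D-0152): KERNEL theorems about ONE sextic extension; no elliptic curve, no named fact, no `sorry`,
no definition.  Closes nothing at the `∀`-level; nothing booked.  For this `Δ > 0` row the road gives input (a) (classical `μ₂ = 0` of `ℚ(θ)`) of the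
narrow-μ door `SteinbergFibreAtTwo.NarrowMu.conjA_two_cubicModel_of_narrowMu`, NOT its input (b); BSD for `293200be1` is NOT proved by this.

MODEL-FREE: stated for ANY number field `F ⊇ K` with `[F : K] = 2` and `s ∈ F`, `s² = 2`, `K` any cubic number field containing a root `θ` of the
cubic; applies verbatim to the abstract layer `κ.layer 1` of every cyclotomic `ℤ₂`-extension `κ` of `K`.

THE ARITHMETIC (exact; seat tools `work/num2/`).  `𝓞_K = ℤ[θ]` (`|disc| = 733`), `2` is unramified in `K`, so `𝓞_F ⊇ ℤ[θ, s]` is `2`-maximal there and all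
certificates live in `ℤ[θ, s]`.  `ξ := (−2 + θ²) + (−1 + θ)s` has `N_{F/K}(ξ) = w := -6 + 3θ + 2θ²` of norm `±2`: `ξ` is a PRIME of `𝓞 F` (`|N(ξ)| = 2`) with
residues `{0,1}` — the prime `𝔔₁` above the degree-one dyadic prime `𝔭₁` of `K` (`F_𝔔₁ = ℚ₂(√2)`, `e = 2`, `f = 1`); `2 = ξ²·w′` with `ξ ∤ w′`,
`2 + s = ξ·μ` with `ξ ∤ μ`.  THE UNIT: `u = −5 + 2θ ∈ 𝓞_K` has `u(r) ≡ ±3 (mod 8)` at the `𝔭₁`-adic root, so `N_{F_𝔔₁/ℚ₂}(u) = u² ≡ 9 (mod 16)` is not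
a unit norm from `ℚ₂(ζ₁₆)⁺`; the certificate: `ε₁ := u·n·c²`, `n = A² − (2+s)Y²` a norm from `F(√(2+s))` (`A = −1 + θ² + s − θ²s`), satisfies
`ε₁ ≡ 1 + ξ⁴ (mod ξ⁵)` (`ε₁ − 1 = ξ⁴z₄`, `z₄ − 1 = ξz₅`), and GEN 11's dyadic lemma `not_exists_sq_sub_mul_sq_fractionRing_of_pow_four_dvd`
(O'Meara 63:10) forbids `x² − (2+s)y² = ε₁`, hence `a² − (2+s)c² = u`.

* `layer_one_ids_d733` — the ring identities of `ℤ[θ, s]` (any commutative ring).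
* `layer_one_dyadic_d733` — `θ, s ∈ 𝓞 F`; `ξ` prime with residues `{0,1}` (norm form of `F/K` + `|N(w)| = 2`).
* ★ `exists_unit_forall_sq_sub_mul_sq_ne_d733` — `∃ η : (𝓞 F)ˣ, ∀ a c : F, a² − (2 + s)·c² ≠ η` (`η = u`).

References: [Omeara1963] §63A–B (63:1, 63:10); [Washington1997] §13.1, §13.3 Prop. 13.22–13.23; [Gras2003] IV.4; [Cohen1993] §4.8.2, §6.3, App. B;
[Marcus1977] Ch. 2 Thm. 4, Ch. 3 Thm. 22; [Lang1990] Ch. 13 §4 Lemma 4.1.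
-/

set_option autoImplicit false
-- sibling precedent: the directory name repeats the summit name
set_option linter.dupNamespace false

noncomputable section

open scoped Classical NumberField nonZeroDivisors

namespace Summit.BirchSwinnertonDyer.BirchSwinnertonDyer.Theorems.AddKatoTwo

open Polynomial IsDedekindDomain NumberField Literature.NumberTheory.NumberFields Literature.NumberTheory.NumberFields.AmbiguousClass
  Literature.NumberTheory.IwasawaTheory

/-! ## §1 The ring identities of `ℤ[θ, s]` -/

/-- **The identities of `ℤ[θ, s]`** (`θ³ − θ² − 7θ + 8 = 0`, `s² = 2`; `b, x` for `θ, s`) in any commutative ring, with `ξ = (−2 + θ²) + (−1 + θ)s`, `w′ = 2/ξ²`,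
`μ = (2+s)/ξ`, the unit `u = −5 + 2θ` and `z_w, z_μ, z₄, z₅` as displayed: `ξ²w′ = 2`; `w′ − 1 = ξz_w`; `ξμ = 2 + s`; `μ − 1 = ξz_μ`; `uu⁻¹ = 1`;
`u·n·c² − 1 = ξ⁴z₄`; `z₄ − 1 = ξz₅`.  Integer `linear_combination`s found by exact reduction (seat `work/num2/red2.py`). [folklore] [cite: Cohen1993, §4.8.2 and §6.3] -/
theorem layer_one_ids_d733 {R : Type*} [CommRing R] (b x : R)
    (Rb : b ^ 3 + (-1) * b ^ 2 + (-7) * b + 8 = 0) (Rx : x ^ 2 = 2) :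
    ((-2 : R) + (-1 : R) * x + (1 : R) * b * x + (1 : R) * b ^ 2) ^ 2 * ((91 : R) + (62 : R) * x + (-99 : R) * b + (-70 : R) * b * x + (25 : R) * b ^ 2 + (18 : R) * b ^ 2 * x) = 2 ∧
    ((91 : R) + (62 : R) * x + (-99 : R) * b + (-70 : R) * b * x + (25 : R) * b ^ 2 + (18 : R) * b ^ 2 * x) - 1 = ((-2 : R) + (-1 : R) * x + (1 : R) * b * x + (1 : R) * b ^ 2) * ((1812 : R) + (1283 : R) * x + (-2291 : R) * b + (-1620 : R) * b * x + (624 : R) * b ^ 2 + (441 : R) * b ^ 2 * x) ∧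
    ((-2 : R) + (-1 : R) * x + (1 : R) * b * x + (1 : R) * b ^ 2) * ((-1 : R) + (-7 : R) * b + (-5 : R) * b * x + (3 : R) * b ^ 2 + (2 : R) * b ^ 2 * x) = 2 + x ∧
    ((-1 : R) + (-7 : R) * b + (-5 : R) * b * x + (3 : R) * b ^ 2 + (2 : R) * b ^ 2 * x) - 1 = ((-2 : R) + (-1 : R) * x + (1 : R) * b * x + (1 : R) * b ^ 2) * ((154 : R) + (107 : R) * x + (-167 : R) * b + (-118 : R) * b * x + (42 : R) * b ^ 2 + (30 : R) * b ^ 2 * x) ∧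
    ((-5 : R) + (2 : R) * b) * ((-13 : R) + (6 : R) * b + (4 : R) * b ^ 2) = 1 ∧
    ((-5 : R) + (2 : R) * b) * (((-1 : R) + (1 : R) * x + (1 : R) * b ^ 2 + (-1 : R) * b ^ 2 * x) ^ 2 - (2 + x) * ((1 : R) * x) ^ 2) * ((1 : R)) ^ 2 - 1 = ((-2 : R) + (-1 : R) * x + (1 : R) * b * x + (1 : R) * b ^ 2) ^ 4 * ((-2443 : R) + (-1727 : R) * x + (3851 : R) * b + (2723 : R) * b * x + (-1144 : R) * b ^ 2 + (-809 : R) * b ^ 2 * x) ∧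
    ((-2443 : R) + (-1727 : R) * x + (3851 : R) * b + (2723 : R) * b * x + (-1144 : R) * b ^ 2 + (-809 : R) * b ^ 2 * x) - 1 = ((-2 : R) + (-1 : R) * x + (1 : R) * b * x + (1 : R) * b ^ 2) * ((-73971 : R) + (-52307 : R) * x + (89917 : R) * b + (63581 : R) * b * x + (-24042 : R) * b ^ 2 + (-17000 : R) * b ^ 2 * x) := by
  refine ⟨?_, ?_, ?_, ?_, ?_, ?_, ?_⟩
  · linear_combination ((130 : R) + (92 : R) * x + (-138 : R) * b + (-98 : R) * b * x + (-2 : R) * b ^ 2 + (-2 : R) * b ^ 2 * x + (25 : R) * b ^ 3 + (18 : R) * b ^ 3 * x) * Rb + ((339 : R) + (62 : R) * x + (-809 : R) * b + (-194 : R) * b * x + (542 : R) * b ^ 2 + (220 : R) * b ^ 2 * x + (43 : R) * b ^ 3 + (-106 : R) * b ^ 3 * x + (-151 : R) * b ^ 4 + (18 : R) * b ^ 4 * x + (36 : R) * b ^ 5) * Rx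
  · linear_combination ((785 : R) + (555 : R) * x + (-624 : R) * b + (-441 : R) * b * x) * Rb + ((1283 : R) + (-2903 : R) * b + (2061 : R) * b ^ 2 + (-441 : R) * b ^ 3) * Rx
  · linear_combination ((3 : R) * b + (2 : R) * b * x) * Rb + ((5 : R) * b + (-7 : R) * b ^ 2 + (2 : R) * b ^ 3) * Rx
  · linear_combination ((65 : R) + (46 : R) * x + (-42 : R) * b + (-30 : R) * b * x) * Rb + ((107 : R) + (-225 : R) * b + (148 : R) * b ^ 2 + (-30 : R) * b ^ 3) * Rx
  · linear_combination ((8 : R)) * Rb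
  · linear_combination ((41490 : R) + (29340 : R) * x + (-97848 : R) * b + (-69188 : R) * b * x + (41482 : R) * b ^ 2 + (29328 : R) * b ^ 2 * x + (44587 : R) * b ^ 3 + (31526 : R) * b ^ 3 * x + (-25409 : R) * b ^ 4 + (-17966 : R) * b ^ 4 * x + (-9464 : R) * b ^ 5 + (-6692 : R) * b ^ 5 * x + (3765 : R) * b ^ 6 + (2662 : R) * b ^ 6 * x + (1144 : R) * b ^ 7 + (809 : R) * b ^ 7 * x) * Rb + ((146419 : R) + (64451 : R) * x + (16259 : R) * x ^ 2 + (1727 : R) * x ^ 3 + (-505800 : R) * b + (-256952 : R) * b * x + (-76855 : R) * b * x ^ 2 + (-9631 : R) * b * x ^ 3 + (517582 : R) * b ^ 2 + (344682 : R) * b ^ 2 * x + (137570 : R) * b ^ 2 * x ^ 2 + (22063 : R) * b ^ 2 * x ^ 3 + (41216 : R) * b ^ 3 + (-103604 : R) * b ^ 3 * x + (-104422 : R) * b ^ 3 * x ^ 2 + (-26482 : R) * b ^ 3 * x ^ 3 + (-338365 : R) * b ^ 4 + (-148684 : R) * b ^ 4 * x + (9275 : R) * b ^ 4 * x ^ 2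 + (17473 : R) * b ^ 4 * x ^ 3 + (95734 : R) * b ^ 5 + (115764 : R) * b ^ 5 * x + (34393 : R) * b ^ 5 * x ^ 2 + (-5959 : R) * b ^ 5 * x ^ 3 + (79226 : R) * b ^ 6 + (962 : R) * b ^ 6 * x + (-19456 : R) * b ^ 6 * x ^ 2 + (809 : R) * b ^ 6 * x ^ 3 + (-31978 : R) * b ^ 7 + (-21470 : R) * b ^ 7 * x + (3236 : R) * b ^ 7 * x ^ 2 + (-7264 : R) * b ^ 8 + (4854 : R) * b ^ 8 * x + (3236 : R) * b ^ 9) * Rx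
  · linear_combination ((-31875 : R) + (-22539 : R) * x + (24042 : R) * b + (17000 : R) * b * x) * Rb + ((-52307 : R) + (115888 : R) * b + (-80581 : R) * b ^ 2 + (17000 : R) * b ^ 3) * Rx

/-! ## §2 The integers `θ, s` of `F = K(√2)`, the prime `ξ`, and the non-norm unit `u` -/

section Field

variable (K F : Type) [Field K] [NumberField K] [Field F] [NumberField F] [Algebra K F]

set_option maxHeartbeats 1600000 in
/-- **The integers `θ, s` of `F ⊇ K ∋ θ` (`θ³ − θ² − 7θ + 8 = 0`, `[K:ℚ] = 3`, `[F:K] = 2`, `s² = 2`) and the dyadic prime `ξ = (−2 + θ²) + (−1 + θ)s`**: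
`bF, sF ∈ 𝓞 F` with `bF = θ`, `sF = s`, the cubic relation, `sF² = 2`, and `ξ` a PRIME ELEMENT of `𝓞 F` with residues `{0, 1}` (`N_{F/K}(ξ) = w`,
`|N_{K/ℚ}(w)| = 2`, via the norm form of the quadratic extension `F = K(s)`, `s ∉ K` by odd degree). KERNEL.
[cite: Omeara1963, §63B (63:10)] [cite: Marcus1977, Ch. 3 Thm. 22] [cite: Washington1997, §13.1] -/
theorem layer_one_dyadic_d733 (h3 : Module.finrank ℚ K = 3) (h2 : Module.finrank K F = 2) (b : 𝓞 K)
    (hb : b ^ 3 + (-1 : ℤ) * b ^ 2 + (-7 : ℤ) * b + (8 : ℤ) = 0) (s : F) (hs : s ^ 2 = 2) :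
    ∃ bF sF : 𝓞 F, (bF : F) = algebraMap (𝓞 K) F b ∧ (sF : F) = s ∧ (bF ^ 3 + (-1) * bF ^ 2 + (-7) * bF + 8 = 0) ∧ sF ^ 2 = 2 ∧
      Prime ((-2 : 𝓞 F) + (-1 : 𝓞 F) * sF + (1 : 𝓞 F) * bF * sF + (1 : 𝓞 F) * bF ^ 2) ∧ (∀ z : 𝓞 F, ((-2 : 𝓞 F) + (-1 : 𝓞 F) * sF + (1 : 𝓞 F) * bF * sF + (1 : 𝓞 F) * bF ^ 2) ∣ z ∨ ((-2 : 𝓞 F) + (-1 : 𝓞 F) * sF + (1 : 𝓞 F) * bF * sF + (1 : 𝓞 F) * bF ^ 2) ∣ z - 1) := by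
  haveI : IsScalarTower ℚ K F := IsScalarTower.of_algebraMap_eq fun q => by simp only [eq_ratCast, map_ratCast]
  haveI : FiniteDimensional K F := Module.Finite.of_restrictScalars_finite ℚ K F
  haveI : Algebra.IsQuadraticExtension K F := ⟨h2⟩
  haveI : IsGalois K F := inferInstance
  have hirr := irreducible_cubic_disc_733
  have hb' : b ^ 3 + (-1) * b ^ 2 + (-7) * b + 8 = 0 := by push_cast at hb; linear_combination hb
  obtain ⟨θ, hθdef⟩ : ∃ t : F, t = algebraMap (𝓞 K) F b := ⟨_, rfl⟩
  have hθK : algebraMap K F (b : K) = θ := by rw [hθdef, IsScalarTower.algebraMap_apply (𝓞 K) K F b]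
  obtain ⟨bF, hbFdef⟩ : ∃ y : 𝓞 F, y = algebraMap (𝓞 K) (𝓞 F) b := ⟨_, rfl⟩
  have hbFval : algebraMap (𝓞 F) F bF = θ := by
    rw [hbFdef, hθdef, ← IsScalarTower.algebraMap_apply (𝓞 K) (𝓞 F) F b]
  have RbF : bF ^ 3 + (-1) * bF ^ 2 + (-7) * bF + 8 = 0 := by
    have h := congrArg (algebraMap (𝓞 K) (𝓞 F)) hb'
    simp only [map_add, map_mul, map_pow, map_neg, map_ofNat, map_one, map_zero] at h
    rw [← hbFdef] at h
    exact h
  have hsint : IsIntegral ℤ s := ⟨X ^ 2 - C 2, monic_X_pow_sub_C _ two_ne_zero, by simp [hs]⟩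
  obtain ⟨sF, hsFval⟩ : ∃ y : 𝓞 F, algebraMap (𝓞 F) F y = s := ⟨⟨s, hsint⟩, rfl⟩
  have RsF : sF ^ 2 = 2 := by
    apply NumberField.RingOfIntegers.coe_injective
    rw [map_pow, hsFval, hs, map_ofNat]
  -- `s ∉ K` (odd degree), so the norm form of `F = K(s)` applies
  have hsq : s ^ 2 = algebraMap K F 2 := by rw [map_ofNat]; exact hs
  have hsK : s ∉ Set.range (algebraMap K F) := by
    rintro ⟨c, hc⟩
    have hc2 : c ^ 2 = 2 := by
      apply (algebraMap K F).injective
      rw [map_pow, hc, hs, map_ofNat]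
    exact sq_ne_two_of_odd_finrank (by rw [h3]; decide) c hc2
  -- the relative norm of `ξ`
  set ξ : F := algebraMap (𝓞 F) F ((-2 : 𝓞 F) + (-1 : 𝓞 F) * sF + (1 : 𝓞 F) * bF * sF + (1 : 𝓞 F) * bF ^ 2) with hξdef
  have hA : algebraMap K F (algebraMap (𝓞 K) K (((-2 : ℤ) : 𝓞 K) + ((0 : ℤ) : 𝓞 K) * b + ((1 : ℤ) : 𝓞 K) * b ^ 2)) =
      ((-2 : ℤ) : F) + ((0 : ℤ) : F) * θ + ((1 : ℤ) : F) * θ ^ 2 := by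
    rw [← IsScalarTower.algebraMap_apply (𝓞 K) K F]
    simp only [map_add, map_mul, map_pow, map_intCast]
    rw [← hθdef]
  have hB : algebraMap K F (algebraMap (𝓞 K) K (((-1 : ℤ) : 𝓞 K) + ((1 : ℤ) : 𝓞 K) * b + ((0 : ℤ) : 𝓞 K) * b ^ 2)) =
      ((-1 : ℤ) : F) + ((1 : ℤ) : F) * θ + ((0 : ℤ) : F) * θ ^ 2 := by
    rw [← IsScalarTower.algebraMap_apply (𝓞 K) K F]
    simp only [map_add, map_mul, map_pow, map_intCast]
    rw [← hθdef]
  have hξAB : ξ = algebraMap K F (algebraMap (𝓞 K) K (((-2 : ℤ) : 𝓞 K) + ((0 : ℤ) : 𝓞 K) * b + ((1 : ℤ) : 𝓞 K) * b ^ 2)) + algebraMap K F (algebraMap (𝓞 K) K (((-1 : ℤ) : 𝓞 K) + ((1 : ℤ) : 𝓞 K) * b + ((0 : ℤ) : 𝓞 K) * b ^ 2)) * s := by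
    rw [hA, hB, hξdef]
    simp only [map_add, map_mul, map_pow, map_neg, map_ofNat, map_one]
    rw [hbFval, hsFval]
    push_cast
    ring
  obtain ⟨a', c', hy, hN⟩ := exists_sq_sub_mul_sq_eq_of_norm_eq h2 hsq hsK ξ
  -- uniqueness of the coordinates on `1, s`
  have hcoord : a' = algebraMap (𝓞 K) K (((-2 : ℤ) : 𝓞 K) + ((0 : ℤ) : 𝓞 K) * b + ((1 : ℤ) : 𝓞 K) * b ^ 2) ∧ c' = algebraMap (𝓞 K) K (((-1 : ℤ) : 𝓞 K) + ((1 : ℤ) : 𝓞 K) * b + ((0 : ℤ) : 𝓞 K) * b ^ 2) := by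
    have heq : algebraMap K F (a' - algebraMap (𝓞 K) K (((-2 : ℤ) : 𝓞 K) + ((0 : ℤ) : 𝓞 K) * b + ((1 : ℤ) : 𝓞 K) * b ^ 2)) = algebraMap K F (algebraMap (𝓞 K) K (((-1 : ℤ) : 𝓞 K) + ((1 : ℤ) : 𝓞 K) * b + ((0 : ℤ) : 𝓞 K) * b ^ 2) - c') * s := by
      rw [map_sub, map_sub]; linear_combination hy.symm.trans hξAB
    by_cases hBc : algebraMap (𝓞 K) K (((-1 : ℤ) : 𝓞 K) + ((1 : ℤ) : 𝓞 K) * b + ((0 : ℤ) : 𝓞 K) * b ^ 2) - c' = 0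
    · rw [hBc, map_zero, zero_mul, map_eq_zero_iff _ (algebraMap K F).injective, sub_eq_zero] at heq
      exact ⟨heq, (sub_eq_zero.mp hBc).symm⟩
    · exact absurd ⟨(a' - algebraMap (𝓞 K) K (((-2 : ℤ) : 𝓞 K) + ((0 : ℤ) : 𝓞 K) * b + ((1 : ℤ) : 𝓞 K) * b ^ 2)) / (algebraMap (𝓞 K) K (((-1 : ℤ) : 𝓞 K) + ((1 : ℤ) : 𝓞 K) * b + ((0 : ℤ) : 𝓞 K) * b ^ 2) - c'),
        by rw [map_div₀, heq, mul_div_cancel_left₀ _ ((map_ne_zero_iff _ (algebraMap K F).injective).mpr hBc)]⟩ hsK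
  have hw : (-6 + 3 * b + 2 * b ^ 2 : 𝓞 K) = (((-2 : ℤ) : 𝓞 K) + ((0 : ℤ) : 𝓞 K) * b + ((1 : ℤ) : 𝓞 K) * b ^ 2) ^ 2 - 2 * (((-1 : ℤ) : 𝓞 K) + ((1 : ℤ) : 𝓞 K) * b + ((0 : ℤ) : 𝓞 K) * b ^ 2) ^ 2 := by
    push_cast
    linear_combination ((-1 : 𝓞 K) + (-1 : 𝓞 K) * b) * hb'
  have hNξ : Algebra.norm K ξ = algebraMap (𝓞 K) K (-6 + 3 * b + 2 * b ^ 2 : 𝓞 K) := by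
    rw [hN, hcoord.1, hcoord.2, hw, map_sub, map_mul, map_pow, map_pow, map_ofNat]
  have hNw : (Algebra.norm ℤ (-6 + 3 * b + 2 * b ^ 2 : 𝓞 K)).natAbs = 2 := by
    have hN' := natAbs_norm_coords_eq_natAbs_normPoly K h3 b (p := -1) (q := -7) (r := 8) hirr hb (-6) 3 2
    have he : (((-6 : ℤ) : 𝓞 K) + ((3 : ℤ) : 𝓞 K) * b + ((2 : ℤ) : 𝓞 K) * b ^ 2) = -6 + 3 * b + 2 * b ^ 2 := by push_cast; ring
    rw [he] at hN'; rw [hN']; norm_num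
  have hNx : (Algebra.norm ℤ ((-2 : 𝓞 F) + (-1 : 𝓞 F) * sF + (1 : 𝓞 F) * bF * sF + (1 : 𝓞 F) * bF ^ 2)).natAbs = 2 := by
    have h1 : ((Algebra.norm ℤ ((-2 : 𝓞 F) + (-1 : 𝓞 F) * sF + (1 : 𝓞 F) * bF * sF + (1 : 𝓞 F) * bF ^ 2) : ℤ) : ℚ) =
        ((Algebra.norm ℤ (-6 + 3 * b + 2 * b ^ 2 : 𝓞 K) : ℤ) : ℚ) := by
      rw [Algebra.coe_norm_int, Algebra.coe_norm_int, NumberField.RingOfIntegers.coe_eq_algebraMap, ← hξdef,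
        ← Algebra.norm_norm (R := ℚ) (S := K) (a := ξ), hNξ]
    have h2' : Algebra.norm ℤ ((-2 : 𝓞 F) + (-1 : 𝓞 F) * sF + (1 : 𝓞 F) * bF * sF + (1 : 𝓞 F) * bF ^ 2) = Algebra.norm ℤ (-6 + 3 * b + 2 * b ^ 2 : 𝓞 K) := by exact_mod_cast h1
    rw [h2', hNw]
  have habs : Ideal.absNorm (Ideal.span {((-2 : 𝓞 F) + (-1 : 𝓞 F) * sF + (1 : 𝓞 F) * bF * sF + (1 : 𝓞 F) * bF ^ 2)}) = 2 := by rw [Ideal.absNorm_span_singleton, hNx]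
  have hP : (Ideal.span {((-2 : 𝓞 F) + (-1 : 𝓞 F) * sF + (1 : 𝓞 F) * bF * sF + (1 : 𝓞 F) * bF ^ 2)}).IsPrime := Ideal.isPrime_of_irreducible_absNorm (by rw [habs]; exact Nat.prime_two)
  have hx0 : ((-2 : 𝓞 F) + (-1 : 𝓞 F) * sF + (1 : 𝓞 F) * bF * sF + (1 : 𝓞 F) * bF ^ 2) ≠ 0 := by
    intro h0; rw [h0, Algebra.norm_zero] at hNx; norm_num at hNx
  have hprime : Prime ((-2 : 𝓞 F) + (-1 : 𝓞 F) * sF + (1 : 𝓞 F) * bF * sF + (1 : 𝓞 F) * bF ^ 2) := (Ideal.span_singleton_prime hx0).mp hP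
  have hcard : Nat.card (𝓞 F ⧸ Ideal.span {((-2 : 𝓞 F) + (-1 : 𝓞 F) * sF + (1 : 𝓞 F) * bF * sF + (1 : 𝓞 F) * bF ^ 2)}) = 2 := by
    rw [← Submodule.cardQuot_apply, ← Ideal.absNorm_apply, habs]
  have hres : ∀ z : 𝓞 F, ((-2 : 𝓞 F) + (-1 : 𝓞 F) * sF + (1 : 𝓞 F) * bF * sF + (1 : 𝓞 F) * bF ^ 2) ∣ z ∨ ((-2 : 𝓞 F) + (-1 : 𝓞 F) * sF + (1 : 𝓞 F) * bF * sF + (1 : 𝓞 F) * bF ^ 2) ∣ z - 1 := by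
    intro z
    by_cases hz : Ideal.Quotient.mk (Ideal.span {((-2 : 𝓞 F) + (-1 : 𝓞 F) * sF + (1 : 𝓞 F) * bF * sF + (1 : 𝓞 F) * bF ^ 2)}) z = 0
    · exact Or.inl (Ideal.mem_span_singleton.mp (Ideal.Quotient.eq_zero_iff_mem.mp hz))
    · right
      have h10 : (1 : 𝓞 F ⧸ Ideal.span {((-2 : 𝓞 F) + (-1 : 𝓞 F) * sF + (1 : 𝓞 F) * bF * sF + (1 : 𝓞 F) * bF ^ 2)}) ≠ 0 := by
        haveI : Nontrivial (𝓞 F ⧸ Ideal.span {((-2 : 𝓞 F) + (-1 : 𝓞 F) * sF + (1 : 𝓞 F) * bF * sF + (1 : 𝓞 F) * bF ^ 2)}) := Ideal.Quotient.nontrivial_iff.mpr hP.ne_top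
        exact one_ne_zero
      obtain ⟨y, -, huniq⟩ := (Nat.card_eq_two_iff' (0 : 𝓞 F ⧸ Ideal.span {((-2 : 𝓞 F) + (-1 : 𝓞 F) * sF + (1 : 𝓞 F) * bF * sF + (1 : 𝓞 F) * bF ^ 2)})).mp hcard
      have h1 : Ideal.Quotient.mk (Ideal.span {((-2 : 𝓞 F) + (-1 : 𝓞 F) * sF + (1 : 𝓞 F) * bF * sF + (1 : 𝓞 F) * bF ^ 2)}) z = 1 := (huniq _ hz).trans (huniq _ h10).symm
      have h0 : Ideal.Quotient.mk (Ideal.span {((-2 : 𝓞 F) + (-1 : 𝓞 F) * sF + (1 : 𝓞 F) * bF * sF + (1 : 𝓞 F) * bF ^ 2)}) (z - 1) = 0 := by rw [map_sub, h1, map_one, sub_self]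
      exact Ideal.mem_span_singleton.mp (Ideal.Quotient.eq_zero_iff_mem.mp h0)
  refine ⟨bF, sF, ?_, hsFval, RbF, RsF, hprime, hres⟩
  rw [NumberField.RingOfIntegers.coe_eq_algebraMap, hbFval, hθdef]

set_option maxHeartbeats 1600000 in
/-- ★ **A unit of `K ∋ θ` (`θ³ − θ² − 7θ + 8 = 0`) that is NOT a norm from `F(√(2+√2))` down to `F = K(√2)`**: for the CUBIC unit `u = −5 + 2θ` of
`𝓞 K ⊆ 𝓞 F` and ALL `a, c ∈ F`: `a² − (2 + s)·c² ≠ u`.  Proof: `ε₁ = u·(A² − (2+s)Y²)·c₀²` with `A = −1 + θ² + s − θ²s` satisfies `ε₁ ≡ 1 + ξ⁴ (mod ξ⁵)` at the prime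
`ξ = (−2 + θ²) + (−1 + θ)s` (`e = 2`, `f = 1`, `2 = ξ²w′`, `ξ ∤ w′`, `2 + s = ξμ`, `ξ ∤ μ`), so `x² − (2+s)y² = ε₁` is impossible
(`not_exists_sq_sub_mul_sq_fractionRing_of_pow_four_dvd`); `a² − (2+s)c² = u` would give it by multiplying norms.  MODEL-FREE `r = 1` input of the
coinvariant-genus road for `293200be1` (at `F = κ.layer 1`). [cite: Omeara1963, §63B (63:10) and §63A (63:1)] [cite: Washington1997, §13.3 Prop. 13.22–13.23]
[cite: Gras2003, IV.4] -/
theorem exists_unit_forall_sq_sub_mul_sq_ne_d733 (h3 : Module.finrank ℚ K = 3) (h2 : Module.finrank K F = 2) (b : 𝓞 K)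
    (hb : b ^ 3 + (-1 : ℤ) * b ^ 2 + (-7 : ℤ) * b + (8 : ℤ) = 0) (s : F) (hs : s ^ 2 = 2) :
    ∃ η : (𝓞 F)ˣ, ∀ a c : F, a ^ 2 - (2 + s) * c ^ 2 ≠ ((η : 𝓞 F) : F) := by
  obtain ⟨bF, sF, -, hsFval, RbF, RsF, hprime, hres⟩ := layer_one_dyadic_d733 K F h3 h2 b hb s hs
  obtain ⟨htwo, hwz, hximu, hmuz, huinv, he1, hz4⟩ := layer_one_ids_d733 bF sF RbF RsF
  have hunit : IsUnit (((-5 : 𝓞 F) + (2 : 𝓞 F) * bF) : 𝓞 F) := IsUnit.of_mul_eq_one _ huinv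
  have hone : ∀ {y z : 𝓞 F}, y - 1 = ((-2 : 𝓞 F) + (-1 : 𝓞 F) * sF + (1 : 𝓞 F) * bF * sF + (1 : 𝓞 F) * bF ^ 2) * z → ¬ ((-2 : 𝓞 F) + (-1 : 𝓞 F) * sF + (1 : 𝓞 F) * bF * sF + (1 : 𝓞 F) * bF ^ 2) ∣ y := by
    rintro y z hyz ⟨c, hc⟩
    exact hprime.not_unit (isUnit_of_dvd_one ⟨c - z, by linear_combination hc - hyz⟩)
  have h2' : (2 : 𝓞 F) = ((-2 : 𝓞 F) + (-1 : 𝓞 F) * sF + (1 : 𝓞 F) * bF * sF + (1 : 𝓞 F) * bF ^ 2) ^ 2 * ((91 : 𝓞 F) + (62 : 𝓞 F) * sF + (-99 : 𝓞 F) * bF + (-70 : 𝓞 F) * bF * sF + (25 : 𝓞 F) * bF ^ 2 + (18 : 𝓞 F) * bF ^ 2 * sF) := htwo.symm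
  have hw : ¬ ((-2 : 𝓞 F) + (-1 : 𝓞 F) * sF + (1 : 𝓞 F) * bF * sF + (1 : 𝓞 F) * bF ^ 2) ∣ ((91 : 𝓞 F) + (62 : 𝓞 F) * sF + (-99 : 𝓞 F) * bF + (-70 : 𝓞 F) * bF * sF + (25 : 𝓞 F) * bF ^ 2 + (18 : 𝓞 F) * bF ^ 2 * sF) := hone hwz
  have hμ : ¬ ((-2 : 𝓞 F) + (-1 : 𝓞 F) * sF + (1 : 𝓞 F) * bF * sF + (1 : 𝓞 F) * bF ^ 2) ∣ ((-1 : 𝓞 F) + (-7 : 𝓞 F) * bF + (-5 : 𝓞 F) * bF * sF + (3 : 𝓞 F) * bF ^ 2 + (2 : 𝓞 F) * bF ^ 2 * sF) := hone hmuz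
  have h4 : ((-2 : 𝓞 F) + (-1 : 𝓞 F) * sF + (1 : 𝓞 F) * bF * sF + (1 : 𝓞 F) * bF ^ 2) ^ 4 ∣ ((-5 : 𝓞 F) + (2 : 𝓞 F) * bF) * (((-1 : 𝓞 F) + (1 : 𝓞 F) * sF + (1 : 𝓞 F) * bF ^ 2 + (-1 : 𝓞 F) * bF ^ 2 * sF) ^ 2 - (2 + sF) * ((1 : 𝓞 F) * sF) ^ 2) * ((1 : 𝓞 F)) ^ 2 - 1 := ⟨_, he1⟩
  have h5 : ¬ ((-2 : 𝓞 F) + (-1 : 𝓞 F) * sF + (1 : 𝓞 F) * bF * sF + (1 : 𝓞 F) * bF ^ 2) ^ 5 ∣ ((-5 : 𝓞 F) + (2 : 𝓞 F) * bF) * (((-1 : 𝓞 F) + (1 : 𝓞 F) * sF + (1 : 𝓞 F) * bF ^ 2 + (-1 : 𝓞 F) * bF ^ 2 * sF) ^ 2 - (2 + sF) * ((1 : 𝓞 F) * sF) ^ 2) * ((1 : 𝓞 F)) ^ 2 - 1 := by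
    rintro ⟨c, hc⟩
    rw [he1] at hc
    have hx0 : ((-2 : 𝓞 F) + (-1 : 𝓞 F) * sF + (1 : 𝓞 F) * bF * sF + (1 : 𝓞 F) * bF ^ 2) ^ 4 ≠ 0 := pow_ne_zero 4 hprime.ne_zero
    have hdiv : ((-2 : 𝓞 F) + (-1 : 𝓞 F) * sF + (1 : 𝓞 F) * bF * sF + (1 : 𝓞 F) * bF ^ 2) ∣ ((-2443 : 𝓞 F) + (-1727 : 𝓞 F) * sF + (3851 : 𝓞 F) * bF + (2723 : 𝓞 F) * bF * sF + (-1144 : 𝓞 F) * bF ^ 2 + (-809 : 𝓞 F) * bF ^ 2 * sF) :=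
      ⟨c, mul_left_cancel₀ hx0 (by linear_combination hc)⟩
    exact hone hz4 hdiv
  have key := not_exists_sq_sub_mul_sq_fractionRing_of_pow_four_dvd F hprime h2' hw hres hμ h4 h5
  have hsv : algebraMap (𝓞 F) F sF = s := hsFval
  have hα := congrArg (algebraMap (𝓞 F) F) hximu
  simp only [map_mul, map_add, map_pow, map_neg, map_ofNat, map_one] at hα
  rw [hsv] at hα
  refine ⟨hunit.unit, fun a c hac => key ⟨(a * ((-1 : F) + (1 : F) * s + (1 : F) * algebraMap (𝓞 F) F bF ^ 2 + (-1 : F) * algebraMap (𝓞 F) F bF ^ 2 * s) + (2 + s) * c * ((1 : F) * s)) * ((1 : F)), (a * ((1 : F) * s) + c * ((-1 : F) + (1 : F) * s + (1 : F) * algebraMap (𝓞 F) F bF ^ 2 + (-1 : F) * algebraMap (𝓞 F) F bF ^ 2 * s)) * ((1 : F)), ?_⟩⟩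
  rw [IsUnit.unit_spec, NumberField.RingOfIntegers.coe_eq_algebraMap] at hac
  simp only [map_add, map_mul, map_neg, map_ofNat] at hac
  simp only [map_mul, map_add, map_sub, map_pow, map_neg, map_ofNat, map_one]
  rw [hsv]
  linear_combination ((((-1 : F) + (1 : F) * s + (1 : F) * algebraMap (𝓞 F) F bF ^ 2 + (-1 : F) * algebraMap (𝓞 F) F bF ^ 2 * s) ^ 2 - (2 + s) * ((1 : F) * s) ^ 2) * ((1 : F)) ^ 2) * hac + (-(((a * ((1 : F) * s) + c * ((-1 : F) + (1 : F) * s + (1 : F) * algebraMap (𝓞 F) F bF ^ 2 + (-1 : F) * algebraMap (𝓞 F) F bF ^ 2 * s)) * ((1 : F))) ^ 2)) * hα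

end Field

end Summit.BirchSwinnertonDyer.BirchSwinnertonDyer.Theorems.AddKatoTwo

end
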